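import Summits.ResolutionOfSingularities.ResolutionOfSingularities.Theorems.FrobeniusLadderFRationalResolutionChartKatoIdeal
import Summits.ResolutionOfSingularities.ResolutionOfSingularities.Theorems.FrobeniusLadderFRationalResolutionStratumModelInterfaces
import Summits.ResolutionOfSingularities.ResolutionOfSingularities.Theorems.FrobeniusLadderFRationalResolutionIntegralHeight
import Summits.ResolutionOfSingularities.ResolutionOfSingularities.Theorems.FrobeniusLadderFRationalResolutionLocalizationQuotientEquiv
import Literature.AlgebraicGeometry.Resolution.LogRegularResolution
import Literature.AlgebraicGeometry.Resolution.TameQuotientSingularitiesResolutionProofs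
import Mathlib.RingTheory.Localization.Integral
import HarnessLib

/-!
# Crux `FrobeniusLadder.FRationalResolution` (stmt-ResolutionOfSingularities-15317), line `redirect`,
# stub `stub_diagonalizableQuotientResolution` — PACKAGING STEP (C4 + C5 of memo
# MEMO-15317-leafhand2-g3 §9): Kato's condition (2.1) for the fixed-point monomial chart at a nearby
# prime, from the `S`-side stratum data

Setting of `…FixedPointLogRegular` / `…ChartKatoIdeal`: `S` a Noetherian algebra of finite type over a
field `k`, graded by a torsion abelian group `A` (`GradedAlgebra 𝒮`, `S₀ = 𝒮 0`), homogeneous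
`x₁,…,x_n ∈ S` of degrees `aᵢ`, the monoid `P = {m ∈ ℤⁿ : m ≥ 0, Σ mᵢ aᵢ = 0}` and the chart
`φ : P → S₀`, `φ(m) = x^m`. Let `𝔔'` be a prime of `S`, `𝔮' = 𝔔' ∩ S₀`, `I = {i : xᵢ ∈ 𝔔'}`, and
`g ∈ S₀ ∖ 𝔔'` with `g • S ⊆ S₀[x]` (`…FixedPointMonomialNhd`) and the contraction property of
`…FixedPointContraction`. THEN, if the stratum `S_𝔔'/(x_I)S_𝔔'` is a regular local ring with
`dim S_𝔔'/(x_I) + |I| = dim S_𝔔'` (`…RsopStrataNhd`) and `dim S_𝔔' = dim (S₀)_𝔮'`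
(`…GoingUpHeight`), the chart `φ` satisfies Kato's (2.1) at `𝔮'`: `LogChart.IsLogRegularAt P φ 𝔮'`.

Mechanism (all landed bricks): put `e = g · ∏_{j ∉ I} x_j^{ord a_j} ∈ S₀ ∖ 𝔔'`, `L = S[e⁻¹]`,
`R₀ = (S₀)[e⁻¹]`, `𝔓 = 𝔔'L`, `q₀ = 𝔓 ∩ R₀`, `J = (x_I)L ∩ R₀`.
(i) `…StratumDescentGradeZero.isRegularLocalRing_model_quotient_of_stratum` (flat descent, Matsumura
23.7) gives regularity of `(R₀/J)_{q₀}`, `…isRegularLocalRing_atPrime_map_mk_of_localization` +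
`comap_model_eq` read it as regularity of `(S₀/J')_{𝔮'}`, `J' = (x_I)L ∩ S₀`, the tree's
`isRegularLocalRing_localization_quotient_iff` as regularity of `(S₀)_𝔮'/J'`, and
`…ChartKatoIdeal.kato_ideal_map_eq_stratum_map` replaces `J'` by Kato's ideal.
(ii) `dim (S₀)_𝔮' = dim S_𝔔' = dim S_𝔔'/(x_I) + |I|`; `dim S_𝔔'/(x_I) = dim (L/(x_I)L)_𝔓̄`
(`…StratumModelInterfaces`) `= dim (R₀/J)_{q̄₀}` (flat + integral: `…IntegralHeight`)
`= dim (S₀)_𝔮'/J'` (`…LocalizationQuotientEquiv`) `= dim (S₀)_𝔮'/K`; and `n − rk F_𝔮' = |I|`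
(`…ChartFace`).

* `isLogRegularAt_chart_of_stratum` — the statement above.

Honest label: packaging brick of the fixed-point route (no stub closed). No definitions, no named
facts, no sorry. [cite: Kato1994, Def. (2.1)] [cite: Matsumura1987, Thm. 23.7 (i)]
-/

noncomputable section

-- single-problem summit: the doubled namespace component is forced
set_option linter.dupNamespace false

open Literature.AlgebraicGeometry.Resolution DirectSum
open Literature.AlgebraicGeometry.Resolution.DiagonalizableQuotient

namespace Summit.ResolutionOfSingularities.ResolutionOfSingularities.Theorems.FRationalResolution.FixedPointChartLogRegular

universe u w

/-! ## Transport helpers along equalities of ideals -/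

/-- Regularity of `(R/J)_{𝔮/J}` transported along equalities `𝔮₁ = 𝔮₂`, `J₁ = J₂`. [folklore] -/
theorem isRegularLocalRing_atPrime_map_mk_congr {R : Type u} [CommRing R] {𝔮₁ 𝔮₂ J₁ J₂ : Ideal R}
    [𝔮₁.IsPrime] [𝔮₂.IsPrime] (h𝔮 : 𝔮₁ = 𝔮₂) (hJ : J₁ = J₂) (hle : J₁ ≤ 𝔮₁)
    (h : haveI : (𝔮₁.map (Ideal.Quotient.mk J₁)).IsPrime := Ideal.isPrime_map_quotientMk_of_isPrime hle
      IsRegularLocalRing (Localization.AtPrime (𝔮₁.map (Ideal.Quotient.mk J₁)))) :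
    haveI : (𝔮₂.map (Ideal.Quotient.mk J₂)).IsPrime :=
      Ideal.isPrime_map_quotientMk_of_isPrime (h𝔮 ▸ hJ ▸ hle)
    IsRegularLocalRing (Localization.AtPrime (𝔮₂.map (Ideal.Quotient.mk J₂))) := by
  subst h𝔮 hJ
  exact h

/-- `dim (R_𝔮 ⧸ J R_𝔮)` transported along equalities `𝔮₁ = 𝔮₂`, `J₁ = J₂`. [folklore] -/
theorem ringKrullDim_atPrime_quotient_congr {R : Type u} [CommRing R] {𝔮₁ 𝔮₂ J₁ J₂ : Ideal R}
    [𝔮₁.IsPrime] [𝔮₂.IsPrime] (h𝔮 : 𝔮₁ = 𝔮₂) (hJ : J₁ = J₂) :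
    ringKrullDim (Localization.AtPrime 𝔮₁ ⧸ J₁.map (algebraMap R (Localization.AtPrime 𝔮₁))) =
      ringKrullDim (Localization.AtPrime 𝔮₂ ⧸ J₂.map (algebraMap R (Localization.AtPrime 𝔮₂))) := by
  subst h𝔮 hJ
  rfl

/-- `dim (T ⧸ K T) = dim (T ⧸ J T)` when `K T = J T`. [folklore] -/
theorem ringKrullDim_quotient_map_congr {R T : Type*} [CommRing R] [CommRing T] [Algebra R T]
    {K J : Ideal R} (h : K.map (algebraMap R T) = J.map (algebraMap R T)) :
    ringKrullDim (T ⧸ K.map (algebraMap R T)) = ringKrullDim (T ⧸ J.map (algebraMap R T)) := by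
  rw [h]

/-- **The fibre prime lies over the base prime, after dividing by compatible ideals.** For an
`R`-algebra `B`, an ideal `I_B` of `B` with `J = I_B ∩ R`, and a prime `𝔓 ⊇ I_B` of `B` with
`q₀ = 𝔓 ∩ R`: `𝔓/I_B` lies over `q₀/J` for the quotient algebra `R/J → B/I_B`. [folklore] -/
theorem liesOver_map_mk {R B : Type*} [CommRing R] [CommRing B] [Algebra R B] (IB : Ideal B)
    (𝔓 : Ideal B) [𝔓.IsPrime] (hI𝔓 : IB ≤ 𝔓) :
    (𝔓.map (Ideal.Quotient.mk IB)).LiesOver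
      ((𝔓.comap (algebraMap R B)).map (Ideal.Quotient.mk (IB.comap (algebraMap R B)))) := by
  constructor
  -- compare after pulling back to `R` along the surjection `R → R/J`
  apply Ideal.comap_injective_of_surjective (Ideal.Quotient.mk (IB.comap (algebraMap R B)))
    Ideal.Quotient.mk_surjective
  rw [Ideal.under_def, Ideal.comap_comap,
    Ideal.comap_map_of_surjective _ Ideal.Quotient.mk_surjective, ← RingHom.ker_eq_comap_bot,
    Ideal.mk_ker, sup_eq_left.mpr (Ideal.comap_mono hI𝔓)]
  have hcomp : (algebraMap (R ⧸ IB.comap (algebraMap R B)) (B ⧸ IB)).comp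
      (Ideal.Quotient.mk (IB.comap (algebraMap R B))) =
      (Ideal.Quotient.mk IB).comp (algebraMap R B) := by
    ext r
    rfl
  rw [hcomp, ← Ideal.comap_comap, Ideal.comap_map_of_surjective _ Ideal.Quotient.mk_surjective,
    ← RingHom.ker_eq_comap_bot, Ideal.mk_ker, sup_eq_left.mpr hI𝔓]

/-- **Fibre dimension zero along a flat integral quotient**: for `R₀ → L` integral (Noetherian), an
ideal `I_L ⊆ 𝔓` (prime) of `L` with `L/I_L` flat over `R₀/(I_L ∩ R₀)`,
`dim (L/I_L)_{𝔓̄} = dim (R₀/(I_L ∩ R₀))_{q̄₀}`, `q₀ = 𝔓 ∩ R₀`. [cite: Matsumura1987, §13 Thm. 19 (2)] -/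
theorem ringKrullDim_atPrime_map_mk_eq_of_flat {R₀ L : Type*} [CommRing R₀] [CommRing L]
    [Algebra R₀ L] [IsNoetherianRing R₀] [IsNoetherianRing L] [Algebra.IsIntegral R₀ L]
    (IL 𝔓 : Ideal L) [𝔓.IsPrime] (hI𝔓 : IL ≤ 𝔓)
    [Module.Flat (R₀ ⧸ IL.comap (algebraMap R₀ L)) (L ⧸ IL)] :
    haveI : (𝔓.map (Ideal.Quotient.mk IL)).IsPrime := Ideal.isPrime_map_quotientMk_of_isPrime hI𝔓
    haveI : ((𝔓.comap (algebraMap R₀ L)).map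
        (Ideal.Quotient.mk (IL.comap (algebraMap R₀ L)))).IsPrime :=
      Ideal.isPrime_map_quotientMk_of_isPrime (Ideal.comap_mono hI𝔓)
    ringKrullDim (Localization.AtPrime (𝔓.map (Ideal.Quotient.mk IL))) =
      ringKrullDim (Localization.AtPrime ((𝔓.comap (algebraMap R₀ L)).map
        (Ideal.Quotient.mk (IL.comap (algebraMap R₀ L))))) := by
  haveI : (𝔓.map (Ideal.Quotient.mk IL)).IsPrime := Ideal.isPrime_map_quotientMk_of_isPrime hI𝔓
  haveI : ((𝔓.comap (algebraMap R₀ L)).map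
      (Ideal.Quotient.mk (IL.comap (algebraMap R₀ L)))).IsPrime :=
    Ideal.isPrime_map_quotientMk_of_isPrime (Ideal.comap_mono hI𝔓)
  haveI := liesOver_map_mk (R := R₀) IL 𝔓 hI𝔓
  exact IntegralHeight.ringKrullDim_atPrime_eq_of_flat_of_isIntegral _ _

variable {k : Type u} [Field k] {A : Type w} [DecidableEq A] [AddCommGroup A] {S : Type u}
  [CommRing S] [Algebra k S] (𝒮 : A → Submodule k S) [GradedAlgebra 𝒮]
  {n : ℕ} (x : Fin n → S) (a : Fin n → A) (hx : ∀ i, x i ∈ 𝒮 (a i))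
  (φ : Multiplicative ↥(AddSubmonoid.nonneg (Fin n → ℤ) ⊓
      AddMonoidHom.mker (Fintype.linearCombination ℤ a).toAddMonoidHom) →* 𝒮 0)
  (hφ : ∀ p, ((φ (Multiplicative.ofAdd p) : 𝒮 0) : S) = ∏ i, x i ^ ((p : Fin n → ℤ) i).toNat)
  (𝔔' : Ideal S) [𝔔'.IsPrime] (I : Finset (Fin n)) (hI : ∀ i, i ∈ I ↔ x i ∈ 𝔔')

include hx hI in
/-- The auxiliary denominator `e = g · ∏_{j ∉ I} x_j^{ord a_j}`: a degree-zero element outside `𝔔'`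
divisible by `g` and by every `x_j`, `j ∉ I`. [folklore] -/
theorem exists_denominator (hA : AddMonoid.IsTorsion A) (g : 𝒮 0) (hg : (g : S) ∉ 𝔔') :
    ∃ e : 𝒮 0, (e : S) ∉ 𝔔' ∧ (g : S) ∣ (e : S) ∧ ∀ j ∉ I, x j ∣ (e : S) := by
  classical
  -- the product of the `x_j^{ord a_j}`, `j ∉ I`, is of degree zero and outside `𝔔'`
  set u : S := ∏ j ∈ Finset.univ.filter (fun j => j ∉ I), x j ^ addOrderOf (a j) with hu
  have hu0 : u ∈ 𝒮 0 := by
    have h := SetLike.prod_mem_graded 𝒮 (F := Finset.univ.filter (fun j => j ∉ I))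
      (i := fun _ => (0 : A)) (g := fun j => x j ^ addOrderOf (a j))
      (fun j _ => pow_addOrderOf_mem_gradeZero 𝒮 (hx j))
    rwa [Finset.sum_const_zero] at h
  have hu𝔔 : u ∉ 𝔔' := by
    rw [hu]
    intro hmem
    obtain ⟨j, hj, hjmem⟩ := (‹𝔔'.IsPrime›.prod_mem_iff).mp hmem
    have hjI : j ∉ I := (Finset.mem_filter.mp hj).2
    exact hjI ((hI j).mpr (‹𝔔'.IsPrime›.mem_of_pow_mem _ hjmem))
  refine ⟨g * ⟨u, hu0⟩, ?_, ?_, ?_⟩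
  · rw [SetLike.GradeZero.coe_mul]
    exact fun h => (‹𝔔'.IsPrime›.mem_or_mem h).elim hg hu𝔔
  · exact ⟨u, by rw [SetLike.GradeZero.coe_mul]⟩
  · intro j hj
    have hpos : 0 < addOrderOf (a j) := (hA (a j)).addOrderOf_pos
    have hdvd : x j ∣ u := by
      rw [hu]
      exact (dvd_pow_self (x j) hpos.ne').trans
        (Finset.dvd_prod_of_mem _ (Finset.mem_filter.mpr ⟨Finset.mem_univ j, hj⟩))
    rw [SetLike.GradeZero.coe_mul]
    exact hdvd.mul_left _


/-- Regularity of `T ⧸ K T` from regularity of `T ⧸ J T` when `K T = J T`. [folklore] -/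
theorem isRegularLocalRing_quotient_map_congr {R T : Type*} [CommRing R] [CommRing T] [Algebra R T]
    {K J : Ideal R} (h : K.map (algebraMap R T) = J.map (algebraMap R T))
    (hJ : IsRegularLocalRing (T ⧸ J.map (algebraMap R T))) :
    IsRegularLocalRing (T ⧸ K.map (algebraMap R T)) := by
  rw [h]
  exact hJ

include hx hφ hI in
/-- **Kato's (2.1) for the fixed-point chart at a nearby prime, from the stratum data.** `S`
Noetherian of finite type over a field, torsion grading, `x` homogeneous with chart `φ(m) = x^m`,
`𝔔'` a prime of `S` with `𝔮' = 𝔔' ∩ S₀`, `I = {i : xᵢ ∈ 𝔔'}`, `g ∈ S₀ ∖ 𝔔'` with `g • S ⊆ S₀[x]` and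
the contraction property. If `S_𝔔'/(x_I)` is a regular local ring, `dim S_𝔔'/(x_I) + |I| = dim S_𝔔'`
and `dim S_𝔔' = dim (S₀)_𝔮'`, then `LogChart.IsLogRegularAt P φ 𝔮'`.
[cite: Kato1994, Def. (2.1)] [cite: Matsumura1987, Thm. 23.7 (i)] -/
theorem isLogRegularAt_chart_of_stratum [IsNoetherianRing S] [Algebra.FiniteType k S]
    (hA : AddMonoid.IsTorsion A) (g : 𝒮 0) (hg : (g : S) ∉ 𝔔')
    (hgen : ∀ s : S, (g : S) * s ∈ Algebra.adjoin (𝒮 0) (Set.range x))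
    (hd : ∀ r : S, r ∈ 𝒮 0 → r ∈ Ideal.span (x '' (↑I : Set (Fin n))) →
      (g : S) * r ∈ Submodule.span (𝒮 0) {μ : S | μ ∈ Submonoid.closure (Set.range x) ∧ μ ∈ 𝒮 0 ∧
        μ ∈ Ideal.span (x '' (↑I : Set (Fin n)))})
    (hreg : IsRegularLocalRing (Localization.AtPrime 𝔔' ⧸
      (Ideal.span (x '' (↑I : Set (Fin n)))).map (algebraMap S (Localization.AtPrime 𝔔'))))
    (hdimS : ringKrullDim (Localization.AtPrime 𝔔' ⧸
        (Ideal.span (x '' (↑I : Set (Fin n)))).map (algebraMap S (Localization.AtPrime 𝔔'))) +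
        (I.card : WithBot ℕ∞) = ringKrullDim (Localization.AtPrime 𝔔'))
    (hdim0 : ringKrullDim (Localization.AtPrime 𝔔') =
      ringKrullDim (Localization.AtPrime (𝔔'.comap (algebraMap (𝒮 0) S)))) :
    LogChart.IsLogRegularAt _ φ (𝔔'.comap (algebraMap (𝒮 0) S)) := by
  classical
  -- ambient data
  haveI : IsNoetherianRing (𝒮 0) := isNoetherianRing_gradeZero 𝒮 hA
  haveI h𝔮p : (𝔔'.comap (algebraMap (𝒮 0) S)).IsPrime := Ideal.IsPrime.comap _
  have hIS𝔔 : Ideal.span (x '' (↑I : Set (Fin n))) ≤ 𝔔' :=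
    Ideal.span_le.mpr (by rintro _ ⟨i, hi, rfl⟩; exact (hI i).mp hi)
  have ha : ∀ i, IsOfFinAddOrder (a i) := fun i => hA (a i)
  -- the denominator `e`, the rings `L = S[e⁻¹]`, `R₀ = S₀[e⁻¹]`
  obtain ⟨e, he𝔔, hge, hxe⟩ := exists_denominator 𝒮 x a hx 𝔔' I hI hA g hg
  haveI hLoc : IsLocalization (Algebra.algebraMapSubmonoid S (Submonoid.powers e))
      (Localization.Away (e : S)) := by
    rw [show Algebra.algebraMapSubmonoid S (Submonoid.powers e) = Submonoid.powers (e : S) from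
      Submonoid.map_powers _ _]
    exact Localization.isLocalization
  letI instAlg : Algebra (Localization.Away e) (Localization.Away (e : S)) :=
    localizationAlgebra (Submonoid.powers e) S
  have hcomm : ∀ c : 𝒮 0, algebraMap (Localization.Away e) (Localization.Away (e : S))
      (algebraMap (𝒮 0) (Localization.Away e) c) = algebraMap S (Localization.Away (e : S)) (c : S) := by
    intro c
    rw [localizationAlgebraMap_def]
    exact IsLocalization.map_eq _ c
  haveI : IsNoetherianRing (Localization.Away e) :=
    IsLocalization.isNoetherianRing (Submonoid.powers e) _ inferInstance
  haveI : IsNoetherianRing (Localization.Away (e : S)) :=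
    IsLocalization.isNoetherianRing (Submonoid.powers (e : S)) _ inferInstance
  -- `𝔓 = 𝔔' L ⊇ (x_I) L`, `𝔓 ∩ S = 𝔔'`
  obtain ⟨h𝔓, hI𝔓, h𝔓S⟩ := StratumDescentGradeZero.isPrime_map_and_le (Localization.Away (e : S))
    (Ideal.span (x '' (↑I : Set (Fin n)))) 𝔔' he𝔔 hIS𝔔
  haveI := h𝔓
  haveI hq₀p : ((𝔔'.map (algebraMap S (Localization.Away (e : S)))).comap
      (algebraMap (Localization.Away e) (Localization.Away (e : S)))).IsPrime :=
    Ideal.IsPrime.comap _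
  have hJq : ((Ideal.span (x '' (↑I : Set (Fin n)))).map
      (algebraMap S (Localization.Away (e : S)))).comap
        (algebraMap (Localization.Away e) (Localization.Away (e : S))) ≤
      (𝔔'.map (algebraMap S (Localization.Away (e : S)))).comap
        (algebraMap (Localization.Away e) (Localization.Away (e : S))) :=
    Ideal.comap_mono hI𝔓
  -- the contracted ideals in `S₀`
  obtain ⟨hq₀𝔮, hJJ'⟩ := StratumDescentGradeZero.comap_model_eq 𝒮 (Localization.Away (e : S))
    (Localization.Away e) hcomm 𝔔' he𝔔
    ((Ideal.span (x '' (↑I : Set (Fin n)))).map (algebraMap S (Localization.Away (e : S))))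
  have hJ'𝔮 : ((Ideal.span (x '' (↑I : Set (Fin n)))).map
      (algebraMap S (Localization.Away (e : S)))).comap
        ((algebraMap S (Localization.Away (e : S))).comp (algebraMap (𝒮 0) S)) ≤
      𝔔'.comap (algebraMap (𝒮 0) S) := by
    intro r hr
    rw [Ideal.mem_comap, RingHom.comp_apply] at hr
    rw [Ideal.mem_comap, ← h𝔓S, Ideal.mem_comap]
    exact hI𝔓 hr
  haveI h𝔮J' := Ideal.isPrime_map_quotientMk_of_isPrime hJ'𝔮
  -- Kato's ideal agrees with `J'` after localising at `𝔮`
  have hKJ' := ChartKatoIdeal.kato_ideal_map_eq_stratum_map 𝒮 x a hx φ hφ 𝔔' I hI g hg hd e he𝔔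
    (Localization.Away (e : S)) (Localization.AtPrime (𝔔'.comap (algebraMap (𝒮 0) S)))
  ---------------------------------------------------------------- (i) regularity
  -- regularity of `(R₀/J)_{q₀/J}`
  have h1 := StratumDescentGradeZero.isRegularLocalRing_model_quotient_of_stratum 𝒮 x a hx I g
    hgen e hge hxe (Localization.Away (e : S)) (Localization.Away e) hcomm 𝔔' he𝔔 hreg hI𝔓
  -- read in `S₀`
  have h2 := StratumDescentGradeZero.isRegularLocalRing_atPrime_map_mk_of_localization
    (R := 𝒮 0) (Submonoid.powers e) _ _ hJq h1
  have h3 := isRegularLocalRing_atPrime_map_mk_congr hq₀𝔮 hJJ' (Ideal.comap_mono hJq) h2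
  have hregJ' := (isRegularLocalRing_localization_quotient_iff _
    (𝔔'.comap (algebraMap (𝒮 0) S)) hJ'𝔮).mpr h3
  ---------------------------------------------------------------- (ii) dimension
  -- `dim S_𝔔'/(x_I) = dim (L/(x_I)L)_𝔓̄`
  have h4 := StratumModelInterfaces.ringKrullDim_stratum_eq x I (Localization.Away (e : S)) 𝔔'
    he𝔔 hI𝔓
  -- `dim (L/(x_I)L)_𝔓̄ = dim (R₀/J)_{q̄₀}` : flat + integral
  haveI := StratumModelInterfaces.flat_stratum_quotient_model 𝒮 x a hx I g hgen e hge hxe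
    (Localization.Away (e : S)) (Localization.Away e) hcomm
  haveI : Algebra.IsIntegral (𝒮 0) S := algebra_isIntegral 𝒮 hA
  haveI : Algebra.IsIntegral (Localization.Away e) (Localization.Away (e : S)) :=
    ⟨isIntegral_localization (R := 𝒮 0) (M := Submonoid.powers e) (S := S)⟩
  have h5 := ringKrullDim_atPrime_map_mk_eq_of_flat (R₀ := Localization.Away e) _ _ hI𝔓
  -- `dim (R₀/J)_{q̄₀} = dim (S₀)_𝔮 / J'`
  have h6 := LocalizationQuotientEquiv.ringKrullDim_atPrime_quotient_eq (R := 𝒮 0)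
    (Submonoid.powers e) _ _ hJq
  have h7 := ringKrullDim_atPrime_quotient_congr hq₀𝔮 hJJ'
  have hfin := h4.trans (h5.trans (h6.symm.trans h7))
  have hB := hdimS
  rw [hfin] at hB
  -- the face rank
  have hJc : ∀ i, i ∈ Finset.univ.filter (fun i => x i ∉ 𝔔') ↔ x i ∉ 𝔔' := fun i => by simp
  have hface := ChartFace.finrank_span_face_chart 𝒮 x a ha φ hφ 𝔔' _ hJc
  have hcard : n - (Finset.univ.filter (fun i => x i ∉ 𝔔')).card = I.card := by
    have hIeq : I = Finset.univ.filter (fun i => x i ∈ 𝔔') := by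
      ext i; simp [hI i]
    have h := Finset.card_filter_add_card_filter_not (s := (Finset.univ : Finset (Fin n)))
      (fun i : Fin n => x i ∈ 𝔔')
    rw [Finset.card_univ, Fintype.card_fin] at h
    rw [hIeq]
    omega
  ---------------------------------------------------------------- assemble
  refine ⟨isRegularLocalRing_quotient_map_congr hKJ' hregJ', ?_⟩
  have hK := ringKrullDim_quotient_map_congr hKJ'
  rw [hface, hcard]
  convert hdim0.symm.trans hB.symm using 2  -- closes the `K`/`J'` summand with `hK`

end Summit.ResolutionOfSingularities.ResolutionOfSingularities.Theorems.FRationalResolution.FixedPointChartLogRegular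

end
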